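import Summits.KontsevichZagierPeriods.KontsevichZagierPeriods.Theorems.SoloInformedCuspPrelim
import Literature.FieldTheory.AlgClosed.PuiseuxAnalyticBranches
import Literature.FieldTheory.AlgClosed.PuiseuxAnalyticBranchesAux
import Literature.FieldTheory.AlgClosed.PuiseuxRealBranchAux
import Literature.FieldTheory.AlgClosed.PuiseuxAtInfinityAlgebraic

/-!
# The analytic germ of a bounded semialgebraic arc at a cusp (Rung 2, file E4b)

Solo programme `solo-KontsevichZagierPeriods-informed`, step L4 of `paper/rung2-v2.md`.

**Input** (`SoloInformedCuspInput`): a continuous bounded real function `G₀` on `(0, η)` and a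
non-zero `P ∈ ℚ̄[x′][y]`, separable over `ℚ̄((x′))`, with `P(x′, G₀ x′) = 0` (`ℚ̄ ⊂ ℂ` = Mathlib's
`algebraicClosure ℚ ℂ`). **Output** (`SoloInformedCuspGerm`): an integer `n ≥ 1`, an étale
equation `G ∈ ℚ̄[s][w]` with a holomorphic root `w = ρ(s)` on a disc `|s| < r`
(`G(s, ρ s) = 0`, `∂_w G(s, ρ s) ≠ 0`, `ρ 0 ∈ ℚ̄`), a polynomial `U ∈ ℚ̄[s]` and `m ∈ ℕ` with

`G₀(sⁿ) = U(s) + s^m ρ(s)` for real `0 < s < r`.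

Proof (real half of Puiseux's theorem, assembled from the tree): formal branches over `ℚ̄`
(`exists_formalBranches`), analytic branches (`exists_analyticBranches`), selection of the real
branch `v₀` of `s^N G₀(sⁿ)` by connectedness (`exists_branch_eqOn`), vanishing of the pole part of
`v₀` from the boundedness of `G₀` (`soloInformed_poly_eq_zero_of_bound`), the étale Taylor shift of
`v₀` (`exists_etaleShift`) with its holomorphic root (`exists_holomorphic_root`), and the
identification of that root with the branch `v₀` by the isolated-zeros principle and Taylor
coefficients below the distinguishing index. [Bochnak–Coste–Roy 1998, §8.1; Kollár 2007, 1.94–1.95]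
-/

noncomputable section

open Set Filter Topology Metric
open scoped Polynomial PowerSeries
open Literature.NumberTheory.Transcendental Literature.FieldTheory.AlgClosed
open Literature.FieldTheory.AlgClosed.PuiseuxInfinityAlgebraic (eval_map_scaleRoots_expand)

namespace Summit.KontsevichZagierPeriods.KontsevichZagierPeriods.Theorems

/-- The field of algebraic numbers `ℚ̄ ⊂ ℂ`. -/
abbrev SoloInformedQbar : Type := algebraicClosure ℚ ℂ

/-- Elements of `ℚ̄` are algebraic. -/
theorem soloInformed_hK_Qbar :
    ∀ a : SoloInformedQbar, IsAlgebraic ℚ (algebraMap SoloInformedQbar ℂ a) :=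
  fun a => mem_algebraicClosure_iff.1 a.2

/-- **Input of the cusp analysis.** -/
structure SoloInformedCuspInput where
  /-- The function (`x′ ↦ g(c + ϵ x′)` in the application). -/
  G₀ : ℝ → ℝ
  /-- Length of the interval. -/
  η : ℝ
  /-- The interval is non-empty. -/
  η_pos : 0 < η
  /-- Continuity on `(0, η)`. -/
  cont : ContinuousOn G₀ (Ioo 0 η)
  /-- A bound. -/
  M : ℝ
  /-- Boundedness on `(0, η)`. -/
  bdd : ∀ x ∈ Ioo 0 η, |G₀ x| ≤ M
  /-- The relation. -/
  P : SoloInformedQbar[X][X]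
  /-- The relation is non-zero. -/
  P_ne : P ≠ 0
  /-- The relation is separable over `ℚ̄((x′))`. -/
  sep : (P.map ((HahnSeries.ofPowerSeries ℤ SoloInformedQbar).comp
    (Polynomial.coeToPowerSeries.ringHom :
      SoloInformedQbar[X] →+* SoloInformedQbar⟦X⟧))).Separable
  /-- `P(x′, G₀ x′) = 0` on `(0, η)`. -/
  rel : ∀ x ∈ Ioo 0 η, soloInformedEvC P (x : ℂ) (G₀ x : ℂ) = 0

/-- **Output of the cusp analysis**: the étale germ. -/
structure SoloInformedCuspGerm (I : SoloInformedCuspInput) where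
  /-- Ramification index. -/
  n : ℕ
  /-- The ramification index is positive. -/
  n_pos : 0 < n
  /-- The étale equation `G(s, w) = 0`. -/
  G : SoloInformedQbar[X][X]
  /-- The polynomial part `U(s)`. -/
  U : SoloInformedQbar[X]
  /-- The exponent of the analytic remainder. -/
  m : ℕ
  /-- The value `ρ(0) ∈ ℚ̄`. -/
  w₀ : SoloInformedQbar
  /-- The holomorphic root. -/
  ρ : ℂ → ℂ
  /-- Radius. -/
  r : ℝ
  /-- The radius is positive. -/
  r_pos : 0 < r
  /-- The radius is at most `1`. -/
  r_le_one : r ≤ 1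
  /-- `sⁿ < η` for `0 < s < r`. -/
  pow_lt : ∀ s ∈ Ioo (0 : ℝ) r, s ^ n < I.η
  /-- `ρ` is analytic on the disc. -/
  analytic : ∀ s ∈ ball (0 : ℂ) r, AnalyticAt ℂ ρ s
  /-- `ρ(0) = w₀`. -/
  ρ_zero : ρ 0 = algebraMap SoloInformedQbar ℂ w₀
  /-- `G(s, ρ s) = 0` on the disc. -/
  root : ∀ s ∈ ball (0 : ℂ) r, soloInformedEvC G s (ρ s) = 0
  /-- `∂_w G(s, ρ s) ≠ 0` on the disc. -/
  etale : ∀ s ∈ ball (0 : ℂ) r, soloInformedEvC (Polynomial.derivative G) s (ρ s) ≠ 0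
  /-- **`G₀(sⁿ) = U(s) + s^m ρ(s)`** for real `0 < s < r`. -/
  real : ∀ s ∈ Ioo (0 : ℝ) r, ((I.G₀ (s ^ n) : ℝ) : ℂ) =
    Polynomial.eval₂ (algebraMap SoloInformedQbar ℂ) (s : ℂ) U + (s : ℂ) ^ m * ρ s

namespace SoloInformedCuspInput

variable (I : SoloInformedCuspInput)

/-- Real points of `(0, δ)`, `δ ≤ r`, lie in the punctured disc of radius `r`. -/
theorem ofReal_mem_ball {δ r : ℝ} (hδr : δ ≤ r) {s : ℝ} (hs : s ∈ Ioo (0 : ℝ) δ) :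
    ((s : ℝ) : ℂ) ∈ ball (0 : ℂ) r ∧ ((s : ℝ) : ℂ) ≠ 0 := by
  refine ⟨?_, by exact_mod_cast hs.1.ne'⟩
  rw [mem_ball, dist_zero_right, Complex.norm_real, Real.norm_eq_abs, abs_of_pos hs.1]
  exact hs.2.trans_le hδr

/-- A shifted branch agreeing near `0` with one of finitely many analytic functions agrees with one
of them eventually (isolated zeros). -/
theorem exists_eventuallyEq {ι : Type*} (S : Finset ι) {Yt : ℂ → ℂ} {Y : ι → ℂ → ℂ}
    (hYt : AnalyticAt ℂ Yt 0) (hY : ∀ v ∈ S, AnalyticAt ℂ (Y v) 0)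
    (h : ∀ᶠ s in 𝓝[≠] (0 : ℂ), ∃ v ∈ S, Yt s = Y v s) :
    ∃ v ∈ S, ∀ᶠ s in 𝓝 (0 : ℂ), Yt s = Y v s := by
  classical
  by_contra hcon
  have hne : ∀ v ∈ S, ∀ᶠ s in 𝓝[≠] (0 : ℂ), Yt s - Y v s ≠ 0 := by
    intro v hv
    rcases (hYt.sub (hY v hv)).eventually_eq_zero_or_eventually_ne_zero with h0 | h0
    · exact absurd ⟨v, hv, h0.mono fun s hs => sub_eq_zero.1 hs⟩ hcon
    · exact h0
  have hall : ∀ᶠ s in 𝓝[≠] (0 : ℂ), ∀ v ∈ S, Yt s - Y v s ≠ 0 :=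
    (Filter.eventually_all_finset S).2 hne
  obtain ⟨s, ⟨v, hv, hsv⟩, hs⟩ := (h.and hall).exists
  exact hs v hv (sub_eq_zero.2 hsv)

/-- **Existence of the étale germ at a cusp.** -/
theorem nonempty_germ : Nonempty (SoloInformedCuspGerm I) := by
  classical
  haveI : IsAlgClosed SoloInformedQbar := (algebraicClosure.isAlgClosure ℚ ℂ).isAlgClosed
  set alg : SoloInformedQbar →+* ℂ := algebraMap SoloInformedQbar ℂ with halg
  -- ### 1. formal branches
  obtain ⟨n, hn, N, S, -, hfact⟩ := exists_formalBranches I.P I.sep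
  set lc : SoloInformedQbar[X] := Polynomial.expand SoloInformedQbar n I.P.leadingCoeff with hlc
  have hlc0 : lc ≠ 0 := by
    rw [hlc, Ne, Polynomial.expand_eq_zero hn, Polynomial.leadingCoeff_eq_zero]
    exact I.P_ne
  have hlc' : (lc : SoloInformedQbar⟦X⟧) ≠ 0 := by
    rw [Ne, ← Polynomial.coe_zero, Polynomial.coe_inj]
    exact hlc0
  set F : SoloInformedQbar[X][X] := Polynomial.scaleRoots (I.P.map
      (Polynomial.expand SoloInformedQbar n :
        SoloInformedQbar[X] →ₐ[SoloInformedQbar] SoloInformedQbar[X]).toRingHom)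
    ((Polynomial.X : SoloInformedQbar[X]) ^ N) with hF
  have hkey : ∀ s : ℂ, s ≠ 0 → ∀ W : ℂ,
      soloInformedEvC F s W = 0 ↔ soloInformedEvC I.P (s ^ n) (W / s ^ N) = 0 := by
    intro s hs W
    unfold soloInformedEvC
    rw [hF, eval_map_scaleRoots_expand (algebraMap SoloInformedQbar ℂ) I.P n N hs W, mul_eq_zero,
      or_iff_right (pow_ne_zero _ (pow_ne_zero N hs))]
  -- ### 2. analytic branches, with a distinguishing shift order
  obtain ⟨N₁, hN₁⟩ := exists_index_coeff_ne S
  obtain ⟨Nv, ρv, r, hr, hNv, hρ, -, hall, hdist⟩ :=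
    exists_analyticBranches F lc S hlc0 hfact (max (N + 1) N₁)
  -- ### 3. the real branch
  set δ : ℝ := min r (min I.η 1) with hδ
  have hδpos : 0 < δ := lt_min hr (lt_min I.η_pos one_pos)
  have hδr : δ ≤ r := min_le_left _ _
  have hδη : δ ≤ I.η := (min_le_right _ _).trans (min_le_left _ _)
  have hδ1 : δ ≤ 1 := (min_le_right _ _).trans (min_le_right _ _)
  have hpow : ∀ s ∈ Ioo (0 : ℝ) δ, s ^ n ∈ Ioo 0 I.η := fun s hs =>
    ⟨pow_pos hs.1 n, lt_of_le_of_lt (pow_le_of_le_one hs.1.le (hs.2.le.trans hδ1) hn.ne')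
      (hs.2.trans_le hδη)⟩
  set Gr : ℝ → ℝ := fun s => s ^ N * I.G₀ (s ^ n) with hGr
  have hGrc : ContinuousOn Gr (Ioo 0 δ) := by
    have h2 : ContinuousOn (fun s : ℝ => I.G₀ (s ^ n)) (Ioo 0 δ) :=
      I.cont.comp (continuous_pow n).continuousOn hpow
    exact ((continuous_pow N).continuousOn).mul h2
  have hYc : ∀ v ∈ S, ∀ s ∈ ball (0 : ℂ) r, ContinuousAt (fun s : ℂ =>
      Polynomial.eval₂ alg s (PowerSeries.trunc (Nv v) v) + s ^ Nv v * ρv v s) s := by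
    intro v hv s hs
    have h1 : Continuous fun s : ℂ => Polynomial.eval₂ alg s (PowerSeries.trunc (Nv v) v) := by
      simpa only [Polynomial.eval_map] using
        Polynomial.continuous ((PowerSeries.trunc (Nv v) v).map alg)
    exact h1.continuousAt.add ((continuousAt_id.pow _).mul (hρ v hv s hs).continuousAt)
  have hex : ∀ s ∈ Ioo (0 : ℝ) δ, ∃ v ∈ S, ((Gr s : ℝ) : ℂ) =
      Polynomial.eval₂ alg s (PowerSeries.trunc (Nv v) v) + (s : ℂ) ^ Nv v * ρv v s := by
    intro s hs
    obtain ⟨hsb, hs0⟩ := ofReal_mem_ball hδr hs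
    have hW : soloInformedEvC F (s : ℂ) ((Gr s : ℝ) : ℂ) = 0 := by
      rw [hkey _ hs0]
      have : ((Gr s : ℝ) : ℂ) / ((s : ℝ) : ℂ) ^ N = ((I.G₀ (s ^ n) : ℝ) : ℂ) := by
        rw [hGr]
        push_cast
        rw [mul_div_cancel_left₀ _ (pow_ne_zero N hs0)]
      rw [this, ← Complex.ofReal_pow]
      exact I.rel _ (hpow s hs)
    exact hall _ hsb hs0 _ hW
  obtain ⟨v₀, hv₀, hGv₀⟩ := exists_branch_eqOn S
    (fun v s => Polynomial.eval₂ alg s (PowerSeries.trunc (Nv v) v) + s ^ Nv v * ρv v s)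
    hδpos hδr hYc hdist Gr hGrc hex
  have hNv₀ : N + 1 ≤ Nv v₀ := (le_max_left _ _).trans (hNv v₀ hv₀)
  have hN₁v₀ : N₁ ≤ Nv v₀ := (le_max_right _ _).trans (hNv v₀ hv₀)
  obtain ⟨d₀, hd₀⟩ : ∃ d, Nv v₀ = N + d := ⟨Nv v₀ - N, by omega⟩
  -- ### 4. the pole part of `v₀` vanishes
  set tl : SoloInformedQbar[X] := soloInformedTail v₀ N d₀ with htl
  have hr2 : 0 < r / 2 := by linarith
  obtain ⟨B₁, hB₁⟩ := (isCompact_closedBall (0 : ℂ) (r / 2)).exists_bound_of_continuousOn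
    (f := ρv v₀) fun s hs => (hρ v₀ hv₀ s (closedBall_subset_ball (by linarith) hs)).continuousAt
      |>.continuousWithinAt
  have htlc : Continuous fun s : ℂ => Polynomial.eval₂ alg s tl := by
    simpa only [Polynomial.eval_map] using Polynomial.continuous (tl.map alg)
  obtain ⟨B₂, hB₂⟩ := (isCompact_closedBall (0 : ℂ) (r / 2)).exists_bound_of_continuousOn
    htlc.continuousOn
  have htrunc0 : PowerSeries.trunc N v₀ = 0 := by
    have hq : (PowerSeries.trunc N v₀).map alg = 0 := by
      refine soloInformed_poly_eq_zero_of_bound (N := N) (C := |I.M| + B₂ + B₁) (δ := min δ (r / 2))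
        (Polynomial.degree_map_le.trans_lt (PowerSeries.degree_trunc_lt v₀ N))
        (lt_min hδpos hr2) fun s hs => ?_
      have hsδ : s ∈ Ioo (0 : ℝ) δ := ⟨hs.1, hs.2.trans_le (min_le_left _ _)⟩
      obtain ⟨-, hs0⟩ := ofReal_mem_ball hδr hsδ
      have hscb : ((s : ℝ) : ℂ) ∈ closedBall (0 : ℂ) (r / 2) := by
        rw [mem_closedBall, dist_zero_right, Complex.norm_real, Real.norm_eq_abs, abs_of_pos hs.1]
        exact (hs.2.trans_le (min_le_right _ _)).le
      have hYs := hGv₀ s hsδ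
      have hsplit : Polynomial.eval₂ alg (s : ℂ) (PowerSeries.trunc (Nv v₀) v₀) =
          ((PowerSeries.trunc N v₀).map alg).eval (s : ℂ) +
            (s : ℂ) ^ N * Polynomial.eval₂ alg s tl := by
        rw [hd₀, soloInformed_trunc_add, Polynomial.eval₂_add, Polynomial.eval₂_mul,
          Polynomial.eval₂_X_pow, Polynomial.eval_map]
      have h1 : ((Gr s : ℝ) : ℂ) = ((PowerSeries.trunc N v₀).map alg).eval (s : ℂ) +
          (s : ℂ) ^ N * Polynomial.eval₂ alg s tl + (s : ℂ) ^ (N + d₀) * ρv v₀ s := by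
        rw [hYs, ← hd₀]
        show Polynomial.eval₂ alg _ _ + _ = _
        rw [hsplit]
      rw [hGr] at h1
      push_cast at h1
      have hq : ((PowerSeries.trunc N v₀).map alg).eval (s : ℂ) = (s : ℂ) ^ N *
          (((I.G₀ (s ^ n) : ℝ) : ℂ) - Polynomial.eval₂ alg s tl - (s : ℂ) ^ d₀ * ρv v₀ s) := by
        rw [pow_add] at h1
        linear_combination -h1
      rw [hq, norm_mul, norm_pow, Complex.norm_real, Real.norm_eq_abs, abs_of_pos hs.1, mul_comm]
      refine mul_le_mul_of_nonneg_right ?_ (pow_nonneg hs.1.le N)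
      have hs1 : s ≤ 1 := (hsδ.2.le.trans hδ1)
      calc ‖((I.G₀ (s ^ n) : ℝ) : ℂ) - Polynomial.eval₂ alg (s : ℂ) tl - (s : ℂ) ^ d₀ * ρv v₀ s‖
          ≤ ‖((I.G₀ (s ^ n) : ℝ) : ℂ)‖ + ‖Polynomial.eval₂ alg (s : ℂ) tl‖ +
            ‖(s : ℂ) ^ d₀ * ρv v₀ s‖ := norm_sub_le_of_le (norm_sub_le _ _) le_rfl
        _ ≤ |I.M| + B₂ + B₁ := by
          gcongr
          · rw [Complex.norm_real, Real.norm_eq_abs]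
            exact (I.bdd _ (hpow s hsδ)).trans (le_abs_self _)
          · exact hB₂ _ hscb
          · rw [norm_mul, norm_pow, Complex.norm_real, Real.norm_eq_abs, abs_of_pos hs.1]
            calc s ^ d₀ * ‖ρv v₀ (s : ℂ)‖ ≤ 1 * B₁ :=
                mul_le_mul (pow_le_one₀ hs.1.le hs1) (hB₁ _ hscb) (norm_nonneg _) zero_le_one
              _ = B₁ := one_mul _
    exact (Polynomial.map_eq_zero_iff alg.injective).1 hq
  -- ### 5. the étale shift of `v₀` and its holomorphic root
  have hroot : (F.map (Polynomial.coeToPowerSeries.ringHom :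
      SoloInformedQbar[X] →+* SoloInformedQbar⟦X⟧)).eval v₀ = 0 := by
    rw [hfact]; exact eval_C_mul_prod_X_sub_C_eq_zero _ S hv₀
  have hsimple : (Polynomial.derivative (F.map (Polynomial.coeToPowerSeries.ringHom :
      SoloInformedQbar[X] →+* SoloInformedQbar⟦X⟧))).eval v₀ ≠ 0 := by
    rw [hfact]; exact eval_derivative_prod_ne_zero hlc' S hv₀
  obtain ⟨N', e, G, hN', hcomp, hG0, hG1⟩ := exists_etaleShift F v₀ hroot hsimple (Nv v₀)
  set w₀ : SoloInformedQbar := PowerSeries.coeff N' v₀ with hw₀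
  have h0 : soloInformedEvC G 0 (alg w₀) = 0 := by
    unfold soloInformedEvC
    rw [halg, eval_map_eval₂RingHom_zero G w₀, hG0, map_zero]
  have h1 : soloInformedEvC (Polynomial.derivative G) 0 (alg w₀) ≠ 0 := by
    unfold soloInformedEvC
    rw [halg, eval_map_eval₂RingHom_zero, ← Polynomial.derivative_map]
    exact fun h => hG1 ((map_eq_zero_iff alg alg.injective).1 h)
  obtain ⟨ρ, hρ0, hρan, hρroot⟩ := exists_holomorphic_root G h0 h1
  have hev_an : ∀ᶠ s in 𝓝 (0 : ℂ), AnalyticAt ℂ ρ s := hρan.eventually_analyticAt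
  have hev_et : ∀ᶠ s in 𝓝 (0 : ℂ), soloInformedEvC (Polynomial.derivative G) s (ρ s) ≠ 0 := by
    have hc : ContinuousAt (fun s => soloInformedEvC (Polynomial.derivative G) s (ρ s)) 0 :=
      (soloInformed_continuous_evC (Polynomial.derivative G)).continuousAt.comp
        (continuousAt_id.prodMk hρan.continuousAt)
    exact hc.eventually_ne (by rw [hρ0]; exact h1)
  -- ### 6. identification of the root with the branch `v₀`
  set T' : SoloInformedQbar[X] := PowerSeries.trunc N' v₀ with hT'
  set Yt : ℂ → ℂ := fun s => (T'.map alg).eval s + s ^ N' * ρ s with hYt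
  have hYt_an : AnalyticAt ℂ Yt 0 :=
    ((AnalyticOnNhd.eval_polynomial (T'.map alg)) 0 (mem_univ _)).add
      ((analyticAt_id.pow N').mul hρan)
  have hYt_root : ∀ᶠ s in 𝓝[≠] (0 : ℂ), ∃ v ∈ S,
      Yt s = ((PowerSeries.trunc (Nv v) v).map alg).eval s + s ^ Nv v * ρv v s := by
    have hb : ∀ᶠ s in 𝓝 (0 : ℂ), s ∈ ball (0 : ℂ) r := ball_mem_nhds 0 hr
    have h' : ∀ᶠ s in 𝓝[≠] (0 : ℂ), s ≠ 0 := self_mem_nhdsWithin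
    filter_upwards [mem_nhdsWithin_of_mem_nhds (hρroot.and hb), h'] with s hs hs0
    have hF0 : soloInformedEvC F s (Yt s) = 0 := by
      show soloInformedEvC F s ((T'.map alg).eval s + s ^ N' * ρ s) = 0
      unfold soloInformedEvC
      rw [Polynomial.eval_map (p := T') alg s, halg,
        eval_shift_of_comp_eq F G T' N' e hcomp s (ρ s)]
      exact mul_eq_zero_of_right _ hs.1
    obtain ⟨v, hv, hvs⟩ := hall s hs.2 hs0 _ hF0
    exact ⟨v, hv, by rw [hvs, Polynomial.eval_map (p := PowerSeries.trunc (Nv v) v) alg s]⟩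
  have hY_an : ∀ v ∈ S, AnalyticAt ℂ
      (fun s : ℂ => ((PowerSeries.trunc (Nv v) v).map alg).eval s + s ^ Nv v * ρv v s) 0 :=
    fun v hv => ((AnalyticOnNhd.eval_polynomial _) 0 (mem_univ _)).add
      ((analyticAt_id.pow _).mul (hρ v hv 0 (mem_ball_self hr)))
  obtain ⟨v₁, hv₁, hv₁eq⟩ := exists_eventuallyEq S hYt_an hY_an hYt_root
  -- Taylor coefficients below the distinguishing index agree, so `v₁ = v₀`
  have hv₁eq' : Yt =ᶠ[𝓝 (0 : ℂ)] fun s : ℂ =>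
      ((PowerSeries.trunc (Nv v₁) v₁).map alg).eval s + s ^ Nv v₁ * ρv v₁ s := hv₁eq
  have hcoeff : ∀ i, i < N₁ → PowerSeries.coeff i v₀ = PowerSeries.coeff i v₁ := by
    intro i hi
    have hiN' : i < N' := lt_of_lt_of_le (lt_of_lt_of_le hi hN₁v₀) hN'
    have hiNv : i < Nv v₁ := lt_of_lt_of_le hi ((le_max_right _ _).trans (hNv v₁ hv₁))
    have hd := Filter.EventuallyEq.iteratedDeriv_eq i hv₁eq'
    rw [hYt, iteratedDeriv_shiftedBranch_zero hρan _ hiN',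
      iteratedDeriv_shiftedBranch_zero (hρ v₁ hv₁ 0 (mem_ball_self hr)) _ hiNv,
      Polynomial.coeff_map, Polynomial.coeff_map, hT', coeff_trunc_of_lt hiN',
      coeff_trunc_of_lt hiNv] at hd
    exact alg.injective (mul_left_cancel₀ (by exact_mod_cast (Nat.factorial_ne_zero i)) hd)
  have hv₁₀ : v₁ = v₀ := by
    by_contra hne
    obtain ⟨i, hi, hne'⟩ := hN₁ v₀ hv₀ v₁ hv₁ (Ne.symm hne)
    exact hne' (hcoeff i hi)
  rw [hv₁₀] at hv₁eq
  -- ### 7. the radius and the conclusion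
  obtain ⟨r₁, hr₁, hball₁⟩ := Metric.eventually_nhds_iff_ball.1
    ((hev_an.and hev_et).and (hρroot.and hv₁eq))
  set r' : ℝ := min δ r₁ with hr'
  have hr'pos : 0 < r' := lt_min hδpos hr₁
  obtain ⟨dN, hdN⟩ : ∃ d, N' = N + d := ⟨N' - N, by omega⟩
  refine ⟨⟨n, hn, G, soloInformedTail v₀ N dN, dN, w₀, ρ, r', hr'pos, (min_le_left _ _).trans hδ1,
    fun s hs => (hpow s ⟨hs.1, hs.2.trans_le (min_le_left _ _)⟩).2,
    fun s hs => (hball₁ s (ball_subset_ball (min_le_right _ _) hs)).1.1, hρ0,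
    fun s hs => (hball₁ s (ball_subset_ball (min_le_right _ _) hs)).2.1,
    fun s hs => (hball₁ s (ball_subset_ball (min_le_right _ _) hs)).1.2, fun s hs => ?_⟩⟩
  have hsδ : s ∈ Ioo (0 : ℝ) δ := ⟨hs.1, hs.2.trans_le (min_le_left _ _)⟩
  obtain ⟨hsb, hs0⟩ := ofReal_mem_ball (min_le_right δ r₁) hs
  have hY : Yt (s : ℂ) = ((PowerSeries.trunc (Nv v₀) v₀).map alg).eval (s : ℂ) +
      (s : ℂ) ^ Nv v₀ * ρv v₀ s := (hball₁ _ hsb).2.2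
  -- `s^N G₀(sⁿ) = Y_{v₀}(s) = Yt s = s^N (tail(s) + s^{dN} ρ s)`
  have h1 := hGv₀ s hsδ
  rw [hGr] at h1
  push_cast at h1
  have h2 : ((PowerSeries.trunc (Nv v₀) v₀).map alg).eval (s : ℂ) + (s : ℂ) ^ Nv v₀ * ρv v₀ s =
      (s : ℂ) ^ N *
        (Polynomial.eval₂ alg (s : ℂ) (soloInformedTail v₀ N dN) + (s : ℂ) ^ dN * ρ s) := by
    rw [← hY, hYt]
    show ((PowerSeries.trunc N' v₀).map alg).eval (s : ℂ) + (s : ℂ) ^ N' * ρ s = _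
    rw [hdN, soloInformed_trunc_eq_X_pow_mul v₀ htrunc0, Polynomial.eval_map, Polynomial.eval₂_mul,
      Polynomial.eval₂_X_pow, pow_add]
    ring
  rw [Polynomial.eval_map] at h2
  have h3 : ((s : ℝ) : ℂ) ^ N * ((I.G₀ (s ^ n) : ℝ) : ℂ) =
      (s : ℂ) ^ N *
        (Polynomial.eval₂ alg (s : ℂ) (soloInformedTail v₀ N dN) + (s : ℂ) ^ dN * ρ s) := by
    rw [← h2]; exact h1
  exact mul_left_cancel₀ (pow_ne_zero N hs0) h3

end SoloInformedCuspInput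

end Summit.KontsevichZagierPeriods.KontsevichZagierPeriods.Theorems
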